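import Summits.Ventures.AbcSig.Sieve.EisensteinChiFast

/-!
# Venture AbcSig — FAST kernel checker for module M6 (trivial-character Eisenstein congruences; σ from factorisations)

HONEST FRAMING. Certificate checker of a COMPUTATION cell (`pub-abcsig`); no Diophantine statement, no claim on ABC or
any summit. `Sieve/Eisenstein.lean` (module M6) evaluates `a_m(G_λ) = −24 Σ_t λ_t (σ₁(m) − t σ₁(m/t))` with `σ₁` as a
divisor sum over `List.range`; that is quadratic in the Sturm bound `B` and only feasible in the kernel for the small
levels of the census (`B ≤ 276`). The A11-1 rows need M6 discharges at `N = 4418, 5618` (`B = 1128, 1431`). This file is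
the trivial-family twin of `Sieve/EisensteinChiFast.lean`: the certificate `EisCertF` carries a trial-division prime
table and, for every `1 ≤ m ≤ B`, the prime factorisation of `m` and of the `m/t` (`t ∣ m`, `t` in the combination), and
`EisCertF.check` computes `σ₁` multiplicatively (`sigmaOfFac`, PROVED equal to `sigmaL` in `EisensteinChiFast.lean`).
THEOREM `EisCertF.check_sound`: the SAME conclusion as `EisCert.check_sound` —
`M.EisensteinCongruent f ψ c.lam c.B ∧ SturmReaches N c.B` (definitions of `Sieve/Eisenstein.lean`, unchanged).

References: as in `Sieve/Eisenstein.lean` ([Sturm 1987, Thm. 1]; [DS05, §4.6]; [BS04, Cor. 3.1]).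
-/

namespace Summit.Ventures.AbcSig

/-- A FAST M6 certificate: prime `(n, θ − r)`, inverses, combination `λ = [(t, λ_t)]` of `E₂(z) − tE₂(tz)`, `B`, the
factorisation of `N`, the prime table `[(p, ⌊√p⌋)]` (= primes of the extended data, in order) and the index rows. -/
structure EisCertF where
  /-- the residue characteristic -/
  n : ℕ
  /-- `θ ≡ r (mod 𝔫)` -/
  r : ℤ
  /-- `(p, u_p)` with `d_p · u_p ≡ 1 (mod n)` -/
  dinv : List (ℕ × ℤ)
  /-- the Eisenstein combination `(t, λ_t)` -/
  lam : List (ℕ × ℤ)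
  /-- number of coefficients compared -/
  B : ℕ
  /-- prime factorisation of the level `N` -/
  facN : List (ℕ × ℕ)
  /-- `(p, k)` with `k = ⌊√p⌋` for the primes `p` of the data `X`, in the order of `X.coeffs` -/
  ptab : List (ℕ × ℕ)
  /-- for `m = 1, …, B`: (factorisation of `m`, [(t, factorisation of `m/t`)]) -/
  rows : List FacRow

/-- The eigenvalue bookkeeping part as an `EisCert` (so `EisCert.eigAt` / `eigZ` / `map_eig_eq` apply). -/
def EisCertF.toEis (c : EisCertF) : EisCert :=
  { n := c.n, r := c.r, dinv := c.dinv, lam := c.lam, B := c.B, facN := c.facN, facs := [] }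

/-- A factorisation is USABLE: right shape and every base has an eigenvalue entry in `X`. -/
def EisCertF.facOK (c : EisCertF) (X : OrbitData) (m : ℕ) (fac : List (ℕ × ℕ)) : Bool :=
  isFacShape m fac && fac.all (fun pk => (c.toEis.eigAt X pk.1).isSome)

/-- The term `λ_t · (−24) · (σ₁(m) − [t ∣ m] t σ₁(m/t))` at an index `m ≥ 1`, from the row (`none` if a needed
factorisation is missing or unusable). -/
def EisCertF.termF (c : EisCertF) (X : OrbitData) (m : ℕ) (row : FacRow) (tl : ℕ × ℤ) : Option ℤ :=
  if m % tl.1 = 0 then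
    match row.quot tl.1 with
    | none => none
    | some f => if c.facOK X (m / tl.1) f then
        some (tl.2 * (-24 * ((sigmaOfFac row.1 : ℤ) - (tl.1 : ℤ) * (sigmaOfFac f : ℤ)))) else none
  else some (tl.2 * (-24 * (sigmaOfFac row.1 : ℤ)))

/-- `Σ_t` of `termF` over the combination (`none` if any term fails). -/
def EisCertF.gsumF (c : EisCertF) (X : OrbitData) (m : ℕ) (row : FacRow) : List (ℕ × ℤ) → Option ℤ
  | [] => some 0
  | tl :: lam =>
      match c.termF X m row tl, c.gsumF X m row lam with
      | some a, some b => some (a + b)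
      | _, _ => none

/-- Check of one index `m ≥ 1`: usable factorisation of `m`, the Eisenstein side evaluates, `a_m(f) ≡ a_m(G_λ) (mod n)`. -/
def EisCertF.checkAt (c : EisCertF) (N : ℕ) (X : OrbitData) (m : ℕ) (row : FacRow) : Bool :=
  c.facOK X m row.1 &&
    match c.gsumF X m row c.lam with
    | none => false
    | some g => (coeffOfFac N (c.toEis.eigZ X) row.1 - g) % (c.n : ℤ) == 0

/-- `checkAt` for the indices `m, m+1, …` against the rows. -/
def EisCertF.checkAll (c : EisCertF) (N : ℕ) (X : OrbitData) : ℕ → List FacRow → Bool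
  | _, [] => true
  | m, row :: rows => c.checkAt N X m row && c.checkAll N X (m + 1) rows

/-- **The fast M6 checker.** `λ` supported on divisors `t > 1` of `N`; `a_0(G_λ) ≡ 0 (mod n)`; `facN` factorises `N`
with `6·B ≥ ψ(N)`; prime table checked and aligned with `X.coeffs`; exactly `B` rows; `checkAt` for `m = 1, …, B`. -/
def EisCertF.check (c : EisCertF) (N : ℕ) (X : OrbitData) : Bool :=
  c.lam.all (fun tl => decide (tl.1 ∣ N) && decide (1 < tl.1)) && (eisCoeff c.lam 0 % (c.n : ℤ) == 0) &&
    isFactorisation N c.facN && decide (psiOfFac c.facN ≤ 6 * c.B) &&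
    c.ptab.all (fun pk => primeCert pk.1 pk.2) && (X.coeffs.map CoeffEntry.ell == c.ptab.map Prod.fst) &&
    (c.rows.length == c.B) && c.checkAll N X 1 c.rows

/-! ## Soundness -/

/-- With a checked prime table, a prime that has an eigenvalue entry IS prime. -/
lemma EisCertF.prime_of_eigAt (c : EisCertF) (X : OrbitData)
    (htab : ∀ pk ∈ c.ptab, primeCert pk.1 pk.2 = true) (hX : X.coeffs.map CoeffEntry.ell = c.ptab.map Prod.fst)
    (p : ℕ) (hp : (c.toEis.eigAt X p).isSome = true) : p.Prime := by
  obtain ⟨v, hv⟩ := Option.isSome_iff_exists.mp hp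
  obtain ⟨e, he, u, hep, -, -⟩ := c.toEis.eigAt_spec X p v hv
  have hmem : p ∈ c.ptab.map Prod.fst := by
    rw [← hX, ← hep]
    exact List.mem_map.mpr ⟨e, he, rfl⟩
  obtain ⟨pk, hpk, hpk1⟩ := List.mem_map.mp hmem
  rw [← hpk1]
  exact primeCert_sound pk.1 pk.2 (htab pk hpk)

/-- A usable factorisation is a factorisation. -/
lemma EisCertF.facOK_sound (c : EisCertF) (X : OrbitData)
    (htab : ∀ pk ∈ c.ptab, primeCert pk.1 pk.2 = true) (hX : X.coeffs.map CoeffEntry.ell = c.ptab.map Prod.fst)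
    (m : ℕ) (fac : List (ℕ × ℕ)) (h : c.facOK X m fac = true) :
    isFactorisation m fac = true ∧ ∀ pk ∈ fac, (c.toEis.eigAt X pk.1).isSome = true := by
  simp only [EisCertF.facOK, Bool.and_eq_true, List.all_eq_true] at h
  exact ⟨isFactorisation_of_shape m fac h.1 (fun pk hpk => c.prime_of_eigAt X htab hX pk.1 (h.2 pk hpk)), h.2⟩

/-- A computed term is the true term `λ_t · eisT t m` (`m ≥ 1`, `row.1` a factorisation of `m`). -/
lemma EisCertF.termF_sound (c : EisCertF) (X : OrbitData)
    (htab : ∀ pk ∈ c.ptab, primeCert pk.1 pk.2 = true) (hX : X.coeffs.map CoeffEntry.ell = c.ptab.map Prod.fst)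
    (m : ℕ) (hm : 1 ≤ m) (row : FacRow) (hrow : isFactorisation m row.1 = true) (tl : ℕ × ℤ) (a : ℤ)
    (h : c.termF X m row tl = some a) : a = tl.2 * eisT tl.1 m := by
  have hm0 : m ≠ 0 := by omega
  have hσ : (sigmaOfFac row.1 : ℤ) = (sigmaL m : ℤ) := by rw [sigmaOfFac_eq_sigmaL m row.1 hrow]
  unfold EisCertF.termF at h
  unfold eisT
  rw [if_neg hm0]
  by_cases hmod : m % tl.1 = 0
  · rw [if_pos hmod] at h
    rw [if_pos (Nat.dvd_of_mod_eq_zero hmod)]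
    split at h
    · simp at h
    · rename_i f hf
      by_cases hfac : c.facOK X (m / tl.1) f = true
      · rw [if_pos hfac] at h
        simp only [Option.some.injEq] at h
        rw [← h, hσ, sigmaOfFac_eq_sigmaL _ f (c.facOK_sound X htab hX _ f hfac).1]
      · rw [if_neg hfac] at h
        simp at h
  · rw [if_neg hmod] at h
    simp only [Option.some.injEq] at h
    have hnd : ¬ tl.1 ∣ m := fun hd => hmod (Nat.mod_eq_zero_of_dvd hd)
    rw [if_neg hnd, ← h, hσ, sub_zero]

/-- The computed sum is `a_m(G_λ) = eisCoeff lam m` (`m ≥ 1`). -/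
lemma EisCertF.gsumF_sound (c : EisCertF) (X : OrbitData)
    (htab : ∀ pk ∈ c.ptab, primeCert pk.1 pk.2 = true) (hX : X.coeffs.map CoeffEntry.ell = c.ptab.map Prod.fst)
    (m : ℕ) (hm : 1 ≤ m) (row : FacRow) (hrow : isFactorisation m row.1 = true) :
    ∀ (lam : List (ℕ × ℤ)) (g : ℤ), c.gsumF X m row lam = some g → g = eisCoeff lam m
  | [], g, h => by simp [EisCertF.gsumF] at h; simp [eisCoeff, ← h]
  | tl :: lam, g, h => by
      unfold EisCertF.gsumF at h
      split at h
      · rename_i a b ha hb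
        simp only [Option.some.injEq] at h
        rw [← h, c.termF_sound X htab hX m hm row hrow tl a ha, c.gsumF_sound X htab hX m hm row hrow lam b hb]
        simp [eisCoeff]
      · simp at h

/-- One index: `checkAt = true` (`m ≥ 1`) gives the congruence for `m` in `k`. -/
lemma EisCertF.checkAt_sound (c : EisCertF) {N : ℕ} (X : OrbitData)
    (htab : ∀ pk ∈ c.ptab, primeCert pk.1 pk.2 = true) (hX : X.coeffs.map CoeffEntry.ell = c.ptab.map Prod.fst)
    (M : NewformModel) (f : M.Form N) (θ : M.Coeff N f)
    (hθ : ∀ e ∈ X.coeffs, (e.d : M.Coeff N f) * M.eig N f e.ell = evalL θ e.g) {k : Type} [Field k]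
    [CharP k c.n] (ψ : M.Coeff N f →+* k) (hψ : ψ θ = (c.r : k)) (m : ℕ) (hm : 1 ≤ m) (row : FacRow)
    (h : c.checkAt N X m row = true) :
    isFactorisation m row.1 = true ∧ ψ (coeffOfFac N (M.eig N f) row.1) = ((eisCoeff c.lam m : ℤ) : k) := by
  unfold EisCertF.checkAt at h
  split at h
  · simp at h
  · rename_i g hg
    simp only [Bool.and_eq_true, beq_iff_eq] at h
    obtain ⟨hok, hcong⟩ := h
    obtain ⟨hfac, hsome⟩ := c.facOK_sound X htab hX m row.1 hok
    refine ⟨hfac, ?_⟩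
    rw [map_coeffOfFac]
    have hchar : CharP k c.toEis.n := ‹CharP k c.n›
    have hc : coeffOfFac N (fun p => ψ (M.eig N f p)) row.1 =
        coeffOfFac N (fun p => ((c.toEis.eigZ X p : ℤ) : k)) row.1 := by
      apply coeffOfFac_congr
      intro pk hpk
      obtain ⟨v, hv⟩ := Option.isSome_iff_exists.mp (hsome pk hpk)
      rw [c.toEis.map_eig_eq X M f θ hθ ψ hψ pk.1 v hv]
      simp [EisCert.eigZ, hv]
    rw [hc]
    have hcast : coeffOfFac N (fun p => ((c.toEis.eigZ X p : ℤ) : k)) row.1 =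
        ((coeffOfFac N (c.toEis.eigZ X) row.1 : ℤ) : k) := by
      have := map_coeffOfFac (Int.castRingHom k) N (c.toEis.eigZ X) row.1
      simpa using this.symm
    rw [hcast, ← c.gsumF_sound X htab hX m hm row hfac c.lam g hg]
    exact intCast_eq_of_emod_eq c.n hcong

/-- All indices (`m₀ ≥ 1`). -/
lemma EisCertF.checkAll_sound (c : EisCertF) {N : ℕ} (X : OrbitData)
    (htab : ∀ pk ∈ c.ptab, primeCert pk.1 pk.2 = true) (hX : X.coeffs.map CoeffEntry.ell = c.ptab.map Prod.fst)
    (M : NewformModel) (f : M.Form N) (θ : M.Coeff N f)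
    (hθ : ∀ e ∈ X.coeffs, (e.d : M.Coeff N f) * M.eig N f e.ell = evalL θ e.g) {k : Type} [Field k]
    [CharP k c.n] (ψ : M.Coeff N f →+* k) (hψ : ψ θ = (c.r : k)) :
    ∀ (rows : List FacRow) (m₀ : ℕ), 1 ≤ m₀ → c.checkAll N X m₀ rows = true →
      ∀ m, m₀ ≤ m → m < m₀ + rows.length → ∃ fac, isFactorisation m fac = true ∧
        ψ (coeffOfFac N (M.eig N f) fac) = ((eisCoeff c.lam m : ℤ) : k)
  | [], m₀, _, _, m, h1, h2 => by simp at h2; omega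
  | row :: rows, m₀, hm₀, h, m, h1, h2 => by
      simp only [EisCertF.checkAll, Bool.and_eq_true] at h
      obtain ⟨hhead, htail⟩ := h
      by_cases hm : m = m₀
      · subst hm
        exact ⟨row.1, c.checkAt_sound X htab hX M f θ hθ ψ hψ m hm₀ row hhead⟩
      · exact c.checkAll_sound X htab hX M f θ hθ ψ hψ rows (m₀ + 1) (by omega) htail m (by omega)
          (by simp only [List.length_cons] at h2; omega)

/-- **Soundness of the fast M6 checker** — same conclusion as `EisCert.check_sound`. -/
theorem EisCertF.check_sound (c : EisCertF) {N : ℕ} (X : OrbitData) (h : c.check N X = true) (M : NewformModel)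
    (f : M.Form N) (θ : M.Coeff N f) (hθ : ∀ e ∈ X.coeffs, (e.d : M.Coeff N f) * M.eig N f e.ell = evalL θ e.g)
    {k : Type} [Field k] [CharP k c.n] (ψ : M.Coeff N f →+* k) (hψ : ψ θ = (c.r : k)) :
    M.EisensteinCongruent f ψ c.lam c.B ∧ SturmReaches N c.B := by
  simp only [EisCertF.check, Bool.and_eq_true, List.all_eq_true, decide_eq_true_eq, beq_iff_eq] at h
  obtain ⟨⟨⟨⟨⟨⟨⟨hlam, h0⟩, hfacN⟩, hpsi⟩, htab⟩, hX⟩, hlen⟩, hall⟩ := h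
  refine ⟨⟨fun tl htl => hlam tl htl, ?_, ?_⟩, ⟨c.facN, hfacN, hpsi⟩⟩
  · have := intCast_eq_of_emod_eq (k := k) c.n (a := eisCoeff c.lam 0) (b := 0) (by simpa using h0)
    simpa using this
  · intro m h1 h2
    exact c.checkAll_sound X htab hX M f θ hθ ψ hψ c.rows 1 le_rfl hall m h1 (by rw [hlen]; omega)

/-! ## Sanity example (kernel) -/

/-- `m = 12`, `λ = [(2, 1)]`: `−24(σ(12) − 2σ(6)) = −24(28 − 24) = −96`; and `m = 9` (odd): `−24σ(9) = −312`. -/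
example : eisCoeff [(2, 1)] 12 = -96 ∧ eisCoeff [(2, 1)] 9 = -312 := by decide +kernel

end Summit.Ventures.AbcSig
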